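/-
Copyright (c) 2026. All rights reserved.
Released under Apache 2.0 license as described in the file LICENSE.
Authors: abc-iut cell, prover seat abc-iut-f-101 (gen 5; row «SB′-D2», abc-iut-L4-lead m136), over the statement of
abc-iut-w5-d144 (`LogFrobeniusMonoTelecoreObservables`, p484312) and its embedding lemmas (`…Emb`, `…EmbTS`), the generic
toolkits `DiagramSinkSystems` / `DiagramPathEmbeddings` (this seat), `DiagramChainFamiliesTwoSided` (abc-iut-w5-d144),
`DiagramOverHomotopies` (abc-iut-w6-d025), abc-iut-L4-t5's universal families, abc-iut-w5-d053's `pushFamily`, and this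
seat's gen-2 telecore `monoTelecore` — nothing of those files is re-meant.
-/
import Literature.AnabelianGeometry.AbsoluteAnabelian.LogFrobeniusMonoTelecoreObservablesShape
import Literature.AnabelianGeometry.AbsoluteAnabelian.DiagramOverHomotopies
import HarnessLib

/-!
# [AbsTopIII] Cor 5.10 (iv)(b), last sentence — sufficiency, part 2/3: the sinks of `D_{An⊢}` and their axioms

S. Mochizuki, *Topics in absolute anabelian geometry III: global reconstruction algorithms*,
J. Math. Sci. Univ. Tokyo 22 (2015) 939–1156 [MochizukiAbsTopIII2015]; locators `p.N` = pages of the author's manuscript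
(`paper:url-5493eb38cbb7`), read on the page: Cor 5.10 (iv)(b) pp. 147–148 ("… give rise to a telecore structure `𝔗_{An⊢}` on
`D•⊢_{≤5} ∪ D•_{≤6}` … Moreover, the respective family of homotopies of `𝔗_{An⊢}` and the observables `S_log`, `S_log⊞` of
Corollary 5.5, (iii), are compatible"), Def 3.5 (ii) p. 75 ("compatible": contained in ONE family with the same homotopies),
Rmk 3.5.1 p. 78 (a core as "a sort of 'constant portion' of the diagram that lies, in a consistent fashion, 'under the entire
diagram'").

Part 2 of 3 (brick D2): the SINKS of the telecore diagram `D_{An⊢}` — at the core vertex `An⊢[𝒩⊢⊞]` ALL co-verticial pairs with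
abc-iut-L4-t5's lifts through the identity structure functor of this seat's `monoTeleOver` (the core family, Def 3.5 (iii));
at `𝒩⊞_v` the boundary pairs of `S_log⊞_v = Hplus v` with source in `D•_{≤2}`, read in `D_{An⊢}` (`plusSinkE`, `plusSinkη`,
via this seat's `LiftPair`); at `𝒩_v` those of `S_log_v = Hts v` (`tsSinkE`, `tsSinkη`); packaged vertex-wise (`SinkAt`, `sinkAt`)
— and the first three axioms of a sink system (`DiagramSinkSystems`): identity on diagonal members (`sink_η_self`), composition
(`sink_trans`), pre-whiskering (`sink_precomp`; abc-iut-w5-d144's sieve property of the embeddings); plus `isOver_sinkη`: every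
sink homotopy lies OVER the core (Rmk 3.5.1), given that the observables' homotopies do (hypotheses `hoverPlus`, `hoverTS`).

OUR kernel constructions over a typed interface; nothing here bears on [IUTchIII] Cor. 3.12; no side taken.
-/

set_option autoImplicit false

universe u

open CategoryTheory Quiver

namespace Literature.AnabelianGeometry.AbsoluteAnabelian

namespace LogFrobeniusSetting

open DiagramOfCategories

variable {Vmod : Type u} {isArc : Vmod → Bool} (L : LogFrobeniusSetting Vmod isArc)

/-! ## The sink system of `D_{An⊢}` -/

section Sink

variable (hN : ∀ v : Vmod, L.monoN v ⋙ L.toEmono v ≅ L.toE v ⋙ L.monoAn)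
  (hψ : ∀ (w : Vmod) (j : {ν : LogVertex (isArc w) // ν.IsCross}),
    L.ψAnMono w j ⋙ L.forgetMono w ⋙ L.toEmono w ≅ L.κAnMono.inverse)
  (Hplus : ∀ v : Vmod, (L.logDiagramPlus v).HomotopyFamily) (Hts : ∀ v : Vmod, (L.logDiagramTS v).HomotopyFamily)

/-- The members of the sink at `𝒩⊞_v`: pairs of paths of `D_{An⊢}` into `𝒩⊞_v` lifting to a boundary pair of `S_log⊞_v` with source
in `D•_{≤2}` (the diagonal at `𝒩⊞_v` itself is left to the generated family). [cite: MochizukiAbsTopIII2015, Cor 5.10 (iv)(b) p. 148] -/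
def plusSinkE (v : Vmod) {a : (monoTeleShape Vmod isArc).Vertex}
    (p q : Path a ((embMonoPlus (monoJ (Vmod := Vmod)) v).obj (logShapePlus (isArc := isArc) v).obs)) : Prop :=
  ∃ w : LiftPair (embMonoPlus monoJ v) L.monoTeleDiagram (logShapePlus v).obs (L.plusComap v (Hplus v)) p q,
    w.src ≠ (logShapePlus (isArc := isArc) v).obs

variable {Hplus} in
/-- A member of the sink at `𝒩⊞_v` is a lifting pair. [cite: MochizukiAbsTopIII2015, Cor 5.10 (iv)(b) p. 148] -/
theorem plusSinkE.liftE {v : Vmod} {a : (monoTeleShape Vmod isArc).Vertex}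
    {p q : Path a ((embMonoPlus (monoJ (Vmod := Vmod)) v).obj (logShapePlus (isArc := isArc) v).obs)}
    (h : L.plusSinkE Hplus v p q) : liftE (embMonoPlus monoJ v) L.monoTeleDiagram (logShapePlus v).obs (L.plusComap v (Hplus v)) p q :=
  h.elim fun w _ => ⟨w⟩

/-- Their homotopies. [cite: MochizukiAbsTopIII2015, Cor 5.10 (iv)(b) p. 148] -/
noncomputable def plusSinkη (v : Vmod) {a : (monoTeleShape Vmod isArc).Vertex}
    {p q : Path a ((embMonoPlus (monoJ (Vmod := Vmod)) v).obj (logShapePlus (isArc := isArc) v).obs)}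
    (h : L.plusSinkE Hplus v p q) : L.monoTeleDiagram.pathFunctor p ⟶ L.monoTeleDiagram.pathFunctor q :=
  liftη (embMonoPlus monoJ v) L.monoTeleDiagram (logShapePlus v).obs (L.plusComap v (Hplus v)) (plusSinkE.liftE L h)

/-- The members of the sink at `𝒩_v`: pairs lifting to a boundary pair of `S_log_v`. [cite: MochizukiAbsTopIII2015, Cor 5.10 (iv)(b) p. 148] -/
def tsSinkE (v : Vmod) {a : (monoTeleShape Vmod isArc).Vertex}
    (p q : Path a ((embMonoTS (monoJ (Vmod := Vmod)) v).obj (logShapeTS (isArc := isArc) v).obs)) : Prop :=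
  liftE (embMonoTS monoJ v) L.monoTeleDiagram (logShapeTS v).obs (L.tsComap v (Hts v)) p q

/-- Their homotopies. [cite: MochizukiAbsTopIII2015, Cor 5.10 (iv)(b) p. 148] -/
noncomputable def tsSinkη (v : Vmod) {a : (monoTeleShape Vmod isArc).Vertex}
    {p q : Path a ((embMonoTS (monoJ (Vmod := Vmod)) v).obj (logShapeTS (isArc := isArc) v).obs)}
    (h : L.tsSinkE Hts v p q) : L.monoTeleDiagram.pathFunctor p ⟶ L.monoTeleDiagram.pathFunctor q :=
  liftη (embMonoTS monoJ v) L.monoTeleDiagram (logShapeTS v).obs (L.tsComap v (Hts v)) h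

/-- A sink pre-family at one vertex of `D_{An⊢}` (members and homotopies). [cite: MochizukiAbsTopIII2015, Definition 3.5 (ii) p.75] -/
structure SinkAt (n : (monoTeleShape Vmod isArc).Vertex) where
  /-- member pairs into `n` -/
  E : ∀ {a : (monoTeleShape Vmod isArc).Vertex}, Path a n → Path a n → Prop
  /-- their homotopies -/
  η : ∀ {a : (monoTeleShape Vmod isArc).Vertex} {p q : Path a n}, E p q →
    (L.monoTeleDiagram.pathFunctor p ⟶ L.monoTeleDiagram.pathFunctor q)

/-- **The sinks of `D_{An⊢}`**: at the core vertex `An⊢` ALL pairs, with abc-iut-L4-t5's lifts through the (identity) structure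
functor (the core family); at `𝒩⊞_v` the embedded `S_log⊞_v`; at `𝒩_v` the embedded `S_log_v`; nothing elsewhere.
[cite: MochizukiAbsTopIII2015, Cor 5.10 (iv)(b) p. 148] -/
noncomputable def sinkAt : ∀ n : (monoTeleShape Vmod isArc).Vertex, L.SinkAt n
  | ExtVertex.obs => ⟨fun _ _ => True, fun {_} {p} {q} _ =>
      (L.monoTeleOver hN hψ).lift (L.monoTeleOver_ff hN hψ _ rfl) p q⟩
  | ExtVertex.base ⟨.nplus v, _⟩ => ⟨fun p q => L.plusSinkE Hplus v p q, fun h => L.plusSinkη Hplus v h⟩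
  | ExtVertex.base ⟨.nv v, _⟩ => ⟨fun p q => L.tsSinkE Hts v p q, fun h => L.tsSinkη Hts v h⟩
  | ExtVertex.base ⟨.row1 _, _⟩ => ⟨fun _ _ => False, fun h => h.elim⟩
  | ExtVertex.base ⟨.core, _⟩ => ⟨fun _ _ => False, fun h => h.elim⟩
  | ExtVertex.base ⟨.e5, _⟩ => ⟨fun _ _ => False, fun h => h.elim⟩
  | ExtVertex.base ⟨.an, _⟩ => ⟨fun _ _ => False, fun h => h.elim⟩
  | ExtVertex.base ⟨.e7, _⟩ => ⟨fun _ _ => False, fun h => h.elim⟩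
  | ExtVertex.base ⟨.nmonoPlus _, _⟩ => ⟨fun _ _ => False, fun h => h.elim⟩
  | ExtVertex.base ⟨.nmono _, _⟩ => ⟨fun _ _ => False, fun h => h.elim⟩
  | ExtVertex.base ⟨.emono5, _⟩ => ⟨fun _ _ => False, fun h => h.elim⟩
  | ExtVertex.base ⟨.anMono, _⟩ => ⟨fun _ _ => False, fun h => h.elim⟩
  | ExtVertex.base ⟨.emono7, _⟩ => ⟨fun _ _ => False, fun h => h.elim⟩

/-- Members live at flagged vertices only. [cite: MochizukiAbsTopIII2015, Cor 5.10 (iv)(b) p. 148] -/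
theorem isObsMono_of_mem {a n : (monoTeleShape Vmod isArc).Vertex} {p q : Path a n}
    (h : (L.sinkAt hN hψ Hplus Hts n).E p q) : isObsMono n = true := by
  rcases n with ⟨⟨k⟩ | _ | ⟨w⟩ | ⟨w⟩ | _ | _ | _ | ⟨w⟩ | ⟨w⟩ | _ | _ | _, hx⟩ | _ <;>
    first | rfl | exact (h : False).elim

end Sink

/-! ## The axioms of a sink system -/

section Axioms

variable (hN : ∀ v : Vmod, L.monoN v ⋙ L.toEmono v ≅ L.toE v ⋙ L.monoAn)
  (hψ : ∀ (w : Vmod) (j : {ν : LogVertex (isArc w) // ν.IsCross}),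
    L.ψAnMono w j ⋙ L.forgetMono w ⋙ L.toEmono w ≅ L.κAnMono.inverse)
  (Hplus : ∀ v : Vmod, (L.logDiagramPlus v).HomotopyFamily) (Hts : ∀ v : Vmod, (L.logDiagramTS v).HomotopyFamily)

/-- Components of a transformation heterogeneously equal to a left whiskering (bookkeeping). [folklore] -/
private theorem app_eq_of_heq_whiskerLeft {A B C : Type*} [Category A] [Category B] [Category C] {R : A ⥤ B}
    {P Q : B ⥤ C} {P' Q' : A ⥤ C} (hP : P' = R ⋙ P) (hQ : Q' = R ⋙ Q) {θ : P ⟶ Q} {θ' : P' ⟶ Q'}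
    (h : HEq θ' (Functor.whiskerLeft R θ)) (x : A) (hx₁ : P'.obj x = P.obj (R.obj x))
    (hx₂ : Q.obj (R.obj x) = Q'.obj x) : θ'.app x = eqToHom hx₁ ≫ θ.app (R.obj x) ≫ eqToHom hx₂ := by
  subst hP hQ; cases h
  exact (eq_of_heq (DiagramOfCategories.HomotopyFamily.heq_eqToHom_comp_comp_eqToHom hx₁ hx₂ _)).symm

/-- The rank of a vertex of `D•_{≤2}` inside `D_{An⊢}` is `0`. [cite: MochizukiAbsTopIII2015, Cor 5.10 (iv)(b) p. 147] -/
theorem rank_embMonoPlus_base (w : Vmod) (x : DSub (DVertex.InFirstRows (isArc := isArc) 2)) :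
    rank ((embMonoPlus (monoJ (Vmod := Vmod)) w).obj ((logShapePlus (isArc := isArc) w).base x)) = 0 := by
  rcases x with ⟨xv, hxv⟩
  cases xv <;> first | rfl | exact absurd hxv.2 (by simp [DVertex.row])

/-- `η_self` for the sinks (Def. 3.5 (ii): identity on diagonal members). [cite: MochizukiAbsTopIII2015, Definition 3.5 (ii) p.75] -/
theorem sink_η_self {a n : (monoTeleShape Vmod isArc).Vertex} {p : Path a n} (h : (L.sinkAt hN hψ Hplus Hts n).E p p) :
    (L.sinkAt hN hψ Hplus Hts n).η h = 𝟙 _ := by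
  rcases n with ⟨⟨k⟩ | _ | ⟨w⟩ | ⟨w⟩ | _ | _ | _ | ⟨w⟩ | ⟨w⟩ | _ | _ | _, hx⟩ | _ <;>
    first
      | exact (h : False).elim
      | exact liftη_self (graphEmbedding_embMonoPlus monoJ w) _
      | exact liftη_self (graphEmbedding_embMonoTS monoJ w) _
      | exact (L.monoTeleOver hN hψ).lift_self _ _

/-- `trans` for the sinks (Def. 3.5 (ii): composition). [cite: MochizukiAbsTopIII2015, Definition 3.5 (ii) p.75] -/
theorem sink_trans {a n : (monoTeleShape Vmod isArc).Vertex} {p q r : Path a n} (h₁ : (L.sinkAt hN hψ Hplus Hts n).E p q)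
    (h₂ : (L.sinkAt hN hψ Hplus Hts n).E q r) :
    ∃ h₃ : (L.sinkAt hN hψ Hplus Hts n).E p r,
      (L.sinkAt hN hψ Hplus Hts n).η h₃ = (L.sinkAt hN hψ Hplus Hts n).η h₁ ≫ (L.sinkAt hN hψ Hplus Hts n).η h₂ := by
  rcases n with ⟨⟨k⟩ | _ | ⟨w⟩ | ⟨w⟩ | _ | _ | _ | ⟨w⟩ | ⟨w⟩ | _ | _ | _, hx⟩ | _
  · exact (h₁ : False).elim
  · exact (h₁ : False).elim
  · obtain ⟨h₃, e⟩ := lift_trans (graphEmbedding_embMonoPlus monoJ w) (plusSinkE.liftE L h₁) (plusSinkE.liftE L h₂)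
    obtain ⟨w₃⟩ := h₃
    obtain ⟨w₁, hw₁⟩ := h₁
    have hs : w₃.src = w₁.src := (graphEmbedding_embMonoPlus monoJ w).obj_injective (w₃.src_eq.trans w₁.src_eq.symm)
    exact ⟨⟨w₃, hs ▸ hw₁⟩, e⟩
  · exact lift_trans (graphEmbedding_embMonoTS monoJ w) h₁ h₂
  · exact (h₁ : False).elim
  · exact (h₁ : False).elim
  · exact (h₁ : False).elim
  · exact (h₁ : False).elim
  · exact (h₁ : False).elim
  · exact (h₁ : False).elim
  · exact (h₁ : False).elim
  · exact (h₁ : False).elim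
  · exact ⟨trivial, ((L.monoTeleOver hN hψ).lift_trans _ p q r).symm⟩

/-- `precomp` for the sinks (Def. 3.5 (ii): pre-whiskering; at `𝒩⊞_v`, `𝒩_v` the path lifts along the sieve, at `An⊢` abc-iut-L4-t5's
`lift_precomp_heq`). [cite: MochizukiAbsTopIII2015, Definition 3.5 (ii) p.75] -/
theorem sink_precomp {c a n : (monoTeleShape Vmod isArc).Vertex} {p q : Path a n} (h : (L.sinkAt hN hψ Hplus Hts n).E p q)
    (r : Path c a) :
    ∃ h' : (L.sinkAt hN hψ Hplus Hts n).E (r.comp p) (r.comp q), ∀ x : L.monoTeleDiagram.obj c,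
      ((L.sinkAt hN hψ Hplus Hts n).η h').app x = eqToHom (L.monoTeleDiagram.pathFunctor_comp_obj r p x) ≫
        ((L.sinkAt hN hψ Hplus Hts n).η h).app ((L.monoTeleDiagram.pathFunctor r).obj x) ≫
          eqToHom (L.monoTeleDiagram.pathFunctor_comp_obj r q x).symm := by
  rcases n with ⟨⟨k⟩ | _ | ⟨w⟩ | ⟨w⟩ | _ | _ | _ | ⟨w⟩ | ⟨w⟩ | _ | _ | _, hx⟩ | _
  · exact (h : False).elim
  · exact (h : False).elim
  · obtain ⟨h', e⟩ := lift_precomp (graphEmbedding_embMonoPlus monoJ w) (isSieve_embMonoPlus monoJ w monoJ_isEmpty_of_isHolomorphic) (plusSinkE.liftE L h) r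
    obtain ⟨w'⟩ := h'
    obtain ⟨w₀, hw₀⟩ := h
    refine ⟨⟨w', fun hs => ?_⟩, e⟩
    -- a lifted source at `𝒩⊞_w` itself would make `r` a path from `𝒩⊞_w` back into `D•_{≤2}`
    rcases hsrc : w₀.src with x | _
    · have ha : rank a = 0 := by rw [← w₀.src_eq, hsrc]; exact rank_embMonoPlus_base w x
      have hc : rank c = 1 := by rw [← w'.src_eq, hs]; rfl
      have := rank_le_of_path r
      omega
    · exact hw₀ hsrc
  · exact lift_precomp (graphEmbedding_embMonoTS monoJ w) (isSieve_embMonoTS monoJ w monoJ_isEmpty_of_isHolomorphic) h r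
  · exact (h : False).elim
  · exact (h : False).elim
  · exact (h : False).elim
  · exact (h : False).elim
  · exact (h : False).elim
  · exact (h : False).elim
  · exact (h : False).elim
  · exact (h : False).elim
  · exact ⟨trivial, fun x => app_eq_of_heq_whiskerLeft (L.monoTeleDiagram.pathFunctor_comp r p)
      (L.monoTeleDiagram.pathFunctor_comp r q) ((L.monoTeleOver hN hψ).lift_precomp_heq _ r p q) x _ _⟩

variable (hoverPlus : ∀ (v : Vmod) (a : (logShapePlus (isArc := isArc) v).Vertex)
    (p q : Path a (logShapePlus (isArc := isArc) v).obs) (h : (Hplus v).E p q),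
    (L.monoTeleOver hN hψ).IsOver ((embMonoPlus (monoJ (Vmod := Vmod)) v).mapPath p)
      ((embMonoPlus (monoJ (Vmod := Vmod)) v).mapPath q) (L.embPlusHom v (Hplus v) h))
  (hoverTS : ∀ (v : Vmod) (a : (logShapeTS (isArc := isArc) v).Vertex)
    (p q : Path a (logShapeTS (isArc := isArc) v).obs) (h : (Hts v).E p q),
    (L.monoTeleOver hN hψ).IsOver ((embMonoTS (monoJ (Vmod := Vmod)) v).mapPath p)
      ((embMonoTS (monoJ (Vmod := Vmod)) v).mapPath q) (L.embTSHom v (Hts v) h))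

include hoverPlus hoverTS in
/-- **Every sink homotopy lies over the core `An⊢[𝒩⊢⊞]`** (the lifts by construction; the observables' by hypothesis — Rmk 3.5.1).
[cite: MochizukiAbsTopIII2015, Remark 3.5.1 p.78] -/
theorem isOver_sinkη {a n : (monoTeleShape Vmod isArc).Vertex} {p q : Path a n} (h : (L.sinkAt hN hψ Hplus Hts n).E p q) :
    (L.monoTeleOver hN hψ).IsOver p q ((L.sinkAt hN hψ Hplus Hts n).η h) := by
  rcases n with ⟨⟨k⟩ | _ | ⟨w⟩ | ⟨w⟩ | _ | _ | _ | ⟨w⟩ | ⟨w⟩ | _ | _ | _, hx⟩ | _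
  · exact (h : False).elim
  · exact (h : False).elim
  · obtain ⟨w₀, hw₀⟩ := h
    obtain ⟨src, left, right, mem, hs, hl, hr⟩ := w₀
    subst hs; cases hl; cases hr
    change (L.monoTeleOver hN hψ).IsOver _ _
      (liftη (embMonoPlus monoJ w) L.monoTeleDiagram (logShapePlus w).obs (L.plusComap w (Hplus w)) _)
    rw [liftη_eq (graphEmbedding_embMonoPlus monoJ w) _ (LiftPair.ofMem mem)]
    exact hoverPlus w src left right ((L.plusComap_E_iff w (Hplus w) left right).mp mem)
  · obtain ⟨w₀⟩ := h
    obtain ⟨src, left, right, mem, hs, hl, hr⟩ := w₀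
    subst hs; cases hl; cases hr
    change (L.monoTeleOver hN hψ).IsOver _ _
      (liftη (embMonoTS monoJ w) L.monoTeleDiagram (logShapeTS w).obs (L.tsComap w (Hts w)) _)
    rw [liftη_eq (graphEmbedding_embMonoTS monoJ w) _ (LiftPair.ofMem mem)]
    exact hoverTS w src left right ((L.tsComap_E_iff w (Hts w) left right).mp mem)
  · exact (h : False).elim
  · exact (h : False).elim
  · exact (h : False).elim
  · exact (h : False).elim
  · exact (h : False).elim
  · exact (h : False).elim
  · exact (h : False).elim
  · exact (h : False).elim
  · exact (L.monoTeleOver hN hψ).isOver_lift _ p q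

end Axioms

end LogFrobeniusSetting

end Literature.AnabelianGeometry.AbsoluteAnabelian
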